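import Literature.MathematicalPhysics.QuantumLattice.YangMillsHeatFlowLocalExistence
import HarnessLib

/-!
# Waldron's Theorem 1.1 on the flat 4-torus (named fact) and the assembly of Cor. 1.2

Mathematical Physics / Quantum Lattice (`QuantumLattice/`). Fact decomposition (librarian,
2026-08-16) of the named fact
`Literature.MathematicalPhysics.QuantumLattice.Waldron2019_yangMillsFlow_flatTorus`
(`YangMillsHeatFlow.lean`; A. Waldron, *Long-time existence for Yang–Mills flow*, Invent. math.
217 (2019), Cor. 1.2: smooth initial data on a compact 4-manifold launch a smooth solution of the
Yang–Mills heat flow for all time — vendored for the trivial `U(N)`-bundle over `ℝ⁴/Lℤ⁴`).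

In the paper Cor. 1.2 is one paragraph: Struwe's short-time existence plus **Theorem 1.1**
("finite-time singularities do not occur": under the energy hypothesis (1.1) the flow has a smooth
limit `A(T) = lim_{t → T} A(t)` in `C^∞_loc`, hence extends). The directory proves that
paragraph completely — semilinear heat well-posedness on `T⁴` (`semilinearHeat_wellPosed_flatTorus`,
`YangMillsHeatFlowLocalExistence.lean`), the DeTurck trick and the gauge ODE
(`YangMillsHeatFlowDeTurck.lean`), the energy identity giving (1.1)
(`YangMillsHeatFlowEnergy*.lean`), the smooth extension to `t = T` and the continuation by
restart, junction and Zorn (`YangMillsHeatFlowContinuation.lean`, `YangMillsHeatFlowFinalTime.lean`)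
— ending in `Waldron2019_yangMillsFlow_flatTorus_of_thm11`: **the named fact follows from
Theorem 1.1 alone**, taken verbatim on the closed flat torus. Theorem 1.1 is the deep result of the
paper (§§2–6: `ε`-regularity, the Bochner formula for `F⁺`, weighted energy identities and the
decay of the self-dual curvature); its tree proof is in progress (`YangMillsHeatFlowBochner.lean`,
`…EpsilonRegularity.lean`, `…WeightedEnergy.lean`, `…Decay.lean`, …) and it had no name so far.

* `Waldron2019_thm11_flatTorus` — **Waldron 2019, Thm. 1.1 on `ℝ⁴/Lℤ⁴`** as a named fact: the
  hypothesis `hW` of `Waldron2019_yangMillsFlow_flatTorus_of_thm11`, verbatim;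
* `Waldron2019_yangMillsFlow_flatTorus_holds_of` — the assembly
  `Waldron2019_thm11_flatTorus → Waldron2019_yangMillsFlow_flatTorus` (one line). The
  decomposition has a single child because the corollary has a single unproved input; the
  discharge `Waldron2019_yangMillsFlow_flatTorus_holds` is this theorem applied to
  `Waldron2019_thm11_flatTorus_holds` once the latter exists.

## References

* A. Waldron, *Long-time existence for Yang–Mills flow*, Invent. math. 217 (2019), 1069–1147,
  Thm. 1.1 (with hypothesis (1.1)), Cor. 1.2, p. 3. [Waldron2019]
* M. Struwe, *The Yang–Mills flow in four dimensions*, Calc. Var. PDE 2 (1994), §4.1. [Struwe1994]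
-/

noncomputable section

open MeasureTheory Set Function Filter Metric Real
open _root_.Topology
open scoped ENNReal NNReal ContDiff

namespace Literature.MathematicalPhysics.QuantumLattice

section Torus

open scoped Matrix.Norms.Frobenius

/-- **Waldron 2019, Theorem 1.1, on the flat 4-torus** ("Let `A(t)` be a smooth solution of (YM)
over a compact four-manifold for `0 ≤ t < T`, satisfying (1.1)
[`sup_t ‖F(t)‖²_{L²} + ∫₀ᵀ ‖D^*F‖²_{L²} dt < ∞`, automatic from the energy identity]. Then
`A(T) = lim_{t→T} A(t)` exists in `C^∞` … In particular finite-time singularities do not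
occur"), for the trivial `U(N)`-bundle over `ℝ⁴/Lℤ⁴`, i.e. `L`-periodic `𝔲(N)`-valued
connections on `ℝ⁴`: IF `B : [0, T) → Connection` is smooth on `[0,T) × ℝ⁴`, `L`-periodic,
`𝔲(N)`-valued, solves `∂ₜB = div_B F_B` (`= −D_B^* F_B`, `divCurvature`) on `(0, T)`, and has
bounded energy on the fundamental cell and bounded `2∫∫‖D^*F‖²` (hypothesis (1.1)), THEN there is
a smooth connection `B_T` with `D^n B(t) → D^n B_T` locally uniformly as `t ↑ T`, for every `n`
(the limit in `C^∞_loc`). This is hypothesis `hW` of `Waldron2019_yangMillsFlow_flatTorus_of_thm11`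
(`YangMillsHeatFlowLocalExistence.lean`), verbatim. [cite: Waldron2019, Thm. 1.1 (hypothesis (1.1)), p. 3] -/
def Waldron2019_thm11_flatTorus : Prop :=
  ∀ (N : ℕ) (L : ℝ), 0 < L → ∀ T : ℝ, 0 < T →
    ∀ B : ℝ → Connection (EuclideanSpace ℝ (Fin 4)) (Matrix (Fin N) (Fin N) ℂ),
      ContDiffOn ℝ ∞ (fun p : ℝ × EuclideanSpace ℝ (Fin 4) => B p.1 p.2) (Ico 0 T ×ˢ univ) →
      (∀ t : ℝ, 0 ≤ t → t < T → (B t).IsLatticePeriodic L) →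
      (∀ t : ℝ, 0 < t → t < T →
        (B t).IsValuedIn (skewAdjoint.submodule ℝ (Matrix (Fin N) (Fin N) ℂ))) →
      (∀ t : ℝ, 0 < t → t < T → ∀ x v : EuclideanSpace ℝ (Fin 4),
        deriv (fun s => B s x v) t = divCurvature (B t) x v) →
      (∃ C : ℝ, ∀ t ∈ Ico 0 T,
        ∫ y in {y | WithLp.ofLp y ∈ Icc (0 : Fin 4 → ℝ) (fun i => (0 : Fin 4 → ℝ) i + L)},
          ymDensityOfBasis (EuclideanSpace.basisFun _ ℝ) (B t) y ≤ C) →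
      (∃ C : ℝ, ∀ t₁ t₂ : ℝ, 0 < t₁ → t₁ ≤ t₂ → t₂ < T →
        2 * ∫ s in t₁..t₂,
          ∫ y in {y | WithLp.ofLp y ∈ Icc (0 : Fin 4 → ℝ) (fun i => (0 : Fin 4 → ℝ) i + L)},
            ∑ j, ‖divCurvature (B s) y (EuclideanSpace.basisFun _ ℝ j)‖ ^ 2 ≤ C) →
      ∃ B_T : Connection (EuclideanSpace ℝ (Fin 4)) (Matrix (Fin N) (Fin N) ℂ),
        IsSmoothConnection B_T ∧
        ∀ n : ℕ, TendstoLocallyUniformly (fun t y => iteratedFDeriv ℝ n (B t) y)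
          (iteratedFDeriv ℝ n B_T) (𝓝[<] T)

/-- **Assembly of Waldron 2019, Cor. 1.2 on the flat 4-torus**: the named fact
`Waldron2019_yangMillsFlow_flatTorus` follows from Theorem 1.1 on the flat torus
(`Waldron2019_thm11_flatTorus`) — by `Waldron2019_yangMillsFlow_flatTorus_of_thm11`, i.e. Struwe's
short-time existence (proved: `semilinearHeat_wellPosed_flatTorus` with the DeTurck trick), the
energy identity, and continuation past every finite time. [cite: Waldron2019, Cor. 1.2 (proof, p. 3)] [cite: Struwe1994, §4.1] -/
theorem Waldron2019_yangMillsFlow_flatTorus_holds_of (h : Waldron2019_thm11_flatTorus) :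
    Waldron2019_yangMillsFlow_flatTorus :=
  Waldron2019_yangMillsFlow_flatTorus_of_thm11 h

end Torus

end Literature.MathematicalPhysics.QuantumLattice

end
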